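import Summits.Ventures.CertifiedArithmetic.LowPrec.GemmThetaLawGenCoverSound
import Summits.Ventures.CertifiedArithmetic.LowPrec.GemmThetaLawGenE2M1
import Summits.Ventures.CertifiedArithmetic.LowPrec.GemmThetaLawGenMixAData
import Summits.Ventures.CertifiedArithmetic.LowPrec.GemmThetaLawGenMixBData

/-!
# Letter-dependent symbolic θ-certificates: the vertex-successor check

HONEST FRAMING (venture CertifiedArithmetic / cell `pub-lowprec`, seat gemm, gen 12 → 13): certified
error envelopes and provably optimal rounding/accumulation schemes for low-precision formats under
stated cost models; every table by two implementations; no hardware or vendor claims.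

A SUPPLEMENT to `GemmThetaLawGenDefs.lawCheck` needed by the soundness chain (cell HANDOFF decision
35, S3/S5): the pair table `pairOK levp sgn` checks the second move of a free-move pair on the
even-residue classes of `levp` AND on the classes of the vertex `t = 0` of the next level (a free
move may land on the binade boundary `t' = M`), the latter built by `classesFor next sgn q₂ none
(some 0)` — whose COVERAGE of the vertex is not part of `coverOK`.  `succOK` decides it: for every
`j ≤ J`, sign and letter, some vertex class of the next level has `π = 0` and a `T`-interval
containing `0` at every admissible `K` (`vtxOK`); `vtxOK_sound` reads it.  KERNEL FACTS: `succOK`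
holds for the three laws whose tables have landed (`e2m1Law`, `e2m3e2m1Law`, `e3m2e2m1Law`).
-/

namespace Literature.ComputerArithmetic.FloatingPoint

namespace MiniFloat

namespace ThetaLaw

namespace LawData

variable (L : LawData)

open AForm

/-- The vertex `t = 0` of level `lev` (sign `sgn`, letter `q`) lies in a vertex class with `π = 0`
at every admissible `K`. [cell] -/
def vtxOK (lev : Lev) (sgn q : ℤ) : Bool :=
  (L.classesFor lev sgn q none (some 0)).any fun c =>
    decide (c.pi = 0) && nonnegOnI (kDom L.K0 L.fixed) ⟨-c.dom.L0, -c.dom.L1, 0⟩ &&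
      nonnegOnI (kDom L.K0 L.fixed) ⟨c.dom.U0, c.dom.U1, 0⟩

/-- THE VERTEX-SUCCESSOR CHECK: every next-level vertex used by the pair tables is covered.
[cell] -/
def succOK : Bool :=
  (List.range (L.J + 1)).all fun j =>
    [1, -1].all fun sgn => L.lam.all fun q =>
      L.vtxOK (if j < L.J then Lev.bin (j + 1) else Lev.top) sgn q

/-- SOUNDNESS OF `vtxOK`: at every admissible `K` the vertex is the member `T = 0` of a vertex
class. [cell] -/
theorem vtxOK_sound {lev : Lev} {sgn q : ℤ} (h : L.vtxOK lev sgn q = true) {K : ℤ}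
    (hK : L.K0 ≤ K) (hfix : L.fixed = true → K = L.K0) :
    ∃ c ∈ L.classesFor lev sgn q none (some 0), c.dom.mem K 0 ∧ (c.g : ℤ) * 0 + c.pi = 0 := by
  unfold vtxOK at h
  simp only [List.any_eq_true, Bool.and_eq_true, decide_eq_true_eq] at h
  obtain ⟨c, hc, ⟨hpi, hlo⟩, hhi⟩ := h
  have hd := kDom_mem (fixed := L.fixed) hK hfix
  have h1 := nonnegOnI_sound hlo hd
  have h2 := nonnegOnI_sound hhi hd
  simp only [eval, mul_zero, add_zero] at h1 h2
  obtain ⟨-, -, -, -, -, hK0, hfx, -⟩ := L.classesFor_mem hc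
  refine ⟨c, hc, ⟨?_, hK0.trans_le hK, fun _ => ⟨by linarith, by linarith⟩, fun _ => rfl⟩, ?_⟩
  · rw [hfx, hK0]; exact hfix
  · rw [hpi]; simp

/-- SOUNDNESS OF `succOK`, per key. [cell] -/
theorem succOK_sound (h : L.succOK = true) {j : ℕ} (hj : j ≤ L.J) {sgn : ℤ}
    (hs : sgn = 1 ∨ sgn = -1) {q : ℤ} (hq : q ∈ L.lam) {K : ℤ} (hK : L.K0 ≤ K)
    (hfix : L.fixed = true → K = L.K0) :
    ∃ c ∈ L.classesFor (if j < L.J then Lev.bin (j + 1) else Lev.top) sgn q none (some 0),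
      c.dom.mem K 0 ∧ (c.g : ℤ) * 0 + c.pi = 0 := by
  unfold succOK at h
  simp only [List.all_eq_true, List.mem_range] at h
  have h' := h j (by omega) sgn (by rcases hs with rfl | rfl <;> simp) q hq
  exact L.vtxOK_sound h' hK hfix

end LawData

/-- KERNEL FACT: the vertex-successor check holds for the E2M1 law. [cell] -/
theorem succOK_e2m1 : e2m1Law.succOK = true := by decide +kernel

/-- KERNEL FACT: the vertex-successor check holds for the E2M3×E2M1 law. [cell] -/
theorem succOK_e2m3e2m1 : e2m3e2m1Law.succOK = true := by
  decide +kernel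

/-- KERNEL FACT: the vertex-successor check holds for the E3M2×E2M1 law. [cell] -/
theorem succOK_e3m2e2m1 : e3m2e2m1Law.succOK = true := by
  decide +kernel

end ThetaLaw

end MiniFloat

end Literature.ComputerArithmetic.FloatingPoint
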